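import Summits.Ventures.QEC.Census.BB.BB144.BZAutMitmZ01a
import Summits.Ventures.QEC.Census.BB.BB144.BZAutMitmZ01b
import Summits.Ventures.QEC.Census.BB.BB144.BZAutMitmZ01c
import HarnessLib

/-!
# `BB144` — meet-in-the-middle replay of the `bz_aut` enumeration matrices, side Z, block 1 (matrix 1, parts 12–14 + block collector)

Matrix 1 (depth 5) of block 1: parts 12–14 (layer 5, groups 3–5), and the collector `bzAutMitmZ_1` over both matrices and all parts.

KERNEL tier (`decide +kernel`, axioms standard): each theorem states that one PART of the meet-in-the-middle replay
(`Census/CertCheckBZMitm.lean`, `DistCert.bzZMitm`) of one enumeration matrix of block 1 of the `bz_aut` certificate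
`7c1e929a56946658` of `[[144,12,12]]` (`BB144.bzAutData`, emitted by qec-search-7) passes: part 0 = layers 1–2 + group
side conditions, part 1 = layer 3 (direct), parts 2–8 = layer 4 on the 7 redundancy-column groups, parts 9–14 = layer 5
on the 6 groups (vacuous for a depth-4 matrix).  With the soundness theorem of `Census/CertCheckBZMitmSound.lean`
these replace the `native_decide` enumeration verdicts (`BZAutEnumZ*.lean`) of the same matrices by KERNEL-checked
ones; no distance value is asserted here.  Generated by HOME/census/search-9/bzmitm/gen_parts.py (qec-search-9).
-/

set_option Elab.async false  -- heavy `decide +kernel` theorems one at a time (gate per-theorem memory guard)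

namespace Summit.Ventures.QEC.Census.BB144

open Summit.Ventures.QEC.Census

set_option maxHeartbeats 400000000 in
/-- `bz_aut` certificate `7c1e929a`, side Z, block 1, matrix 1: part 12 of the meet-in-the-middle replay passes. -/
theorem bzAutMitmZ_1_1_12 : cert.bzZMitm bzAutData 1 1 12 = true := by
  decide +kernel

set_option maxHeartbeats 400000000 in
/-- `bz_aut` certificate `7c1e929a`, side Z, block 1, matrix 1: part 13 of the meet-in-the-middle replay passes. -/
theorem bzAutMitmZ_1_1_13 : cert.bzZMitm bzAutData 1 1 13 = true := by
  decide +kernel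

set_option maxHeartbeats 400000000 in
/-- `bz_aut` certificate `7c1e929a`, side Z, block 1, matrix 1: part 14 of the meet-in-the-middle replay passes. -/
theorem bzAutMitmZ_1_1_14 : cert.bzZMitm bzAutData 1 1 14 = true := by
  decide +kernel

/-- **Block 1, side Z**: every part of the meet-in-the-middle replay of both enumeration matrices passes. -/
theorem bzAutMitmZ_1 : ∀ i, i < 2 → ∀ p, p < 15 → cert.bzZMitm bzAutData 1 i p = true := by
  intro i hi p hp
  interval_cases i <;> interval_cases p
  · exact bzAutMitmZ_1_0_0
  · exact bzAutMitmZ_1_0_1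
  · exact bzAutMitmZ_1_0_2
  · exact bzAutMitmZ_1_0_3
  · exact bzAutMitmZ_1_0_4
  · exact bzAutMitmZ_1_0_5
  · exact bzAutMitmZ_1_0_6
  · exact bzAutMitmZ_1_0_7
  · exact bzAutMitmZ_1_0_8
  · exact bzAutMitmZ_1_0_9
  · exact bzAutMitmZ_1_0_10
  · exact bzAutMitmZ_1_0_11
  · exact bzAutMitmZ_1_0_12
  · exact bzAutMitmZ_1_0_13
  · exact bzAutMitmZ_1_0_14
  · exact bzAutMitmZ_1_1_0
  · exact bzAutMitmZ_1_1_1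
  · exact bzAutMitmZ_1_1_2
  · exact bzAutMitmZ_1_1_3
  · exact bzAutMitmZ_1_1_4
  · exact bzAutMitmZ_1_1_5
  · exact bzAutMitmZ_1_1_6
  · exact bzAutMitmZ_1_1_7
  · exact bzAutMitmZ_1_1_8
  · exact bzAutMitmZ_1_1_9
  · exact bzAutMitmZ_1_1_10
  · exact bzAutMitmZ_1_1_11
  · exact bzAutMitmZ_1_1_12
  · exact bzAutMitmZ_1_1_13
  · exact bzAutMitmZ_1_1_14

end Summit.Ventures.QEC.Census.BB144
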